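import Literature.AlgebraicGeometry.HodgeTheory.LevelOneSubHodgeStructuresOfCurvesRankTwo
import Literature.AlgebraicGeometry.Motives.AbelianVarietyExistence

/-!
# Route `SecondaryPeriods`, crux `ConiveauOneFailure` (stmt-HodgeConjecture-3540): a rank-two
# attractor plane is realised by an elliptic curve WITH its abelian-variety structure

The heart of the registered line of the crux (`stub_attractorPlane_offCurveCorrespondences`,
`Cruxes/ConiveauOneFailure/Lines/birth.lean`) asks for a Calabi–Yau-type threefold `Y` and a rational
rank-two level-one sub-Hodge structure `V ⊂ H³(Y(ℂ))` carried by no algebraic curve correspondence.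
The tree realises every such `V` as `φ(H¹(C(ℂ)))` for SOME smooth projective curve `C` and a rational
type-`(1,1)` map `φ` (`exists_curve_of_levelOne_threefold_span_of_finrank_eq_two`, Riemann's theorem
in rank two: one-dimensional polarised tori are elliptic curves by uniformisation) — but the curve is
hidden behind an existential, so that consumers cannot use WHICH curve it is. For the habitat
restriction of the heart proved in the sequel
(`Theorems/SecondaryPeriodsConiveauOneFailureAbelianNoGo`: no ABELIAN threefold is a witness, granted
Markman's 2025 theorem "HC for abelian varieties of dimension `≤ 5`", applied to the abelian FOURFOLD
`Y × E`) one needs the realising curve to be an elliptic curve `E` together with its group law, i.e. a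
bundled `Motives.AbelianVariety ℂ` of dimension `1` whose underlying scheme is `C`. This file and its
sequel `Theorems/SecondaryPeriodsConiveauOneFailureLevelOneReductionInClass` thread that information
through the layers of the tree's proof, changing nothing else. Here, the two bottom layers:

* `exists_abelianVariety_isAnalytification_complexTorus_dimOne` — every one-dimensional complex torus
  `ℂ¹/Φ(ℤ^ι)` is the analytification of the Weierstrass cubic `E_Λ` of its lattice (the tree's
  `exists_isAnalytification_complexTorus_dimOne`, Silverman VI Prop. 3.6 (b)), and `E_Λ` with the
  chord–tangent law IS a one-dimensional abelian variety (`WeierstrassCurve.abelianVarietyOfAddHom`,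
  `Motives.dim_abelianVarietyOfAddHom`, Silverman III.3.6) whose underlying scheme is `E_Λ` by `rfl`;
* `weightOne_polarizable_of_finrank_eq_two_abelian` — **Riemann's theorem in rank two with the curve
  remembered as an abelian variety**: every polarisable effective weight-one `ℚ`-Hodge structure of
  dimension `2` is a Hodge quotient of `H¹(E(ℂ); ℚ)` of a one-dimensional complex abelian variety
  (proof of `weightOne_geometric_of_lefschetzAt` verbatim).

Everything is proved (axioms `propext`, `Classical.choice`, `Quot.sound`); no definition, no named
fact. TODO(general form): the abelian form of rank-two Riemann is a pure strengthening of
`weightOne_polarizable_of_finrank_eq_two` and belongs in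
`Literature/AlgebraicGeometry/HodgeTheory/WeightOneHodgeStructuresRankTwo`.

## References

* [VoisinHodgeI2002] C. Voisin, Hodge Theory and Complex Algebraic Geometry I, CUP 2002, §7.2.2,
  §7.3.1 (Def. 7.22, Lemma 7.26).
* [KerrPearlstein2016] M. Kerr, G. Pearlstein (eds.), Recent Advances in Hodge Theory, CUP 2016,
  Ch. 11 (S. Abdulali), §1 p. 288 and Prop. 3.2 p. 291.
* [LangeBirkenhake1992] H. Lange, Ch. Birkenhake, Complex Abelian Varieties, Springer 1992,
  Thm. 2.1.18, Cor. 2.1.14.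
* [SilvermanAEC2009] J. H. Silverman, The Arithmetic of Elliptic Curves, III.3.6, VI Prop. 3.6 (b).
-/

noncomputable section

-- every declaration of this problem lives in `Summit.HodgeConjecture.HodgeConjecture.…` (summit = sub-problem), which `linter.dupNamespace` flags
set_option linter.dupNamespace false

namespace Summit.HodgeConjecture.HodgeConjecture.Theorems

open scoped TensorProduct Manifold Topology
open CategoryTheory AlgebraicGeometry
open Literature.AlgebraicTopology.SingularHomology
open Literature.AlgebraicGeometry Literature.AlgebraicGeometry.HodgeTheory
open Literature.AlgebraicGeometry.Motives (HodgeStructure SchemeOver IsSmoothProjective ComplexPoints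
  AbelianVariety)
open Literature.AlgebraicGeometry.Motives.HodgeStructure
open Literature.NumberTheory.Transcendental Literature.Geometry.Kaehler

/-! ### One-dimensional tori are analytifications of elliptic curves, as abelian varieties -/

/-- **Every one-dimensional complex torus is the analytification of a one-dimensional complex
abelian variety.** For every period isomorphism `Φ : ℝ^ι ≃ ℂ¹` the torus `ComplexTorus Φ` is the
analytification of a smooth projective curve `X` which is the underlying scheme of an abelian
variety `E` over `ℂ` of dimension `1`: `X = E_Λ` the Weierstrass cubic of the lattice
`Λ = {(Φm)₀} = ℤω₀ + ℤω₁` (proof of `exists_isAnalytification_complexTorus_dimOne` verbatim,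
Silverman VI Prop. 3.6 (b)), `E = E_Λ` with the chord–tangent group law
(`WeierstrassCurve.abelianVarietyOfAddHom` on `addHom`/`negHom`, Silverman III.3.6), `E.X = X` by
`rfl`, `dim E = 1` (`Motives.dim_abelianVarietyOfAddHom`). [cite: SilvermanAEC2009, VI Prop. 3.6 (b) and III.3.6]
[cite: LangeBirkenhake1992, §2.1 Cor. 2.1.14] -/
theorem exists_abelianVariety_isAnalytification_complexTorus_dimOne ⦃ι : Type⦄ [Fintype ι]
    (Φ : (ι → ℝ) ≃L[ℝ] (Fin 1 → ℂ)) :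
    ∃ (X : SchemeOver ℂ), (∃ E : AbelianVariety ℂ, E.dim = 1 ∧ E.X = X) ∧
      ∃ (_ : IsSmoothProjective 1 X) (φ : ComplexTorus Φ → ComplexPoints X),
        IsAnalytification (Fin 1 → ℂ) X 1 φ := by
  classical
  -- `|ι| = 2`
  have hcard : Fintype.card ι = 2 := by
    have h := Φ.toLinearEquiv.finrank_eq
    rw [Module.finrank_fintype_fun_eq_card] at h
    rw [h]
    simp [Module.finrank_pi_fintype, Complex.finrank_real_complex]
  let σ : ι ≃ Fin 2 := Fintype.equivFinOfCardEq hcard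
  have hne : σ.symm 0 ≠ σ.symm 1 := fun h => by simpa using σ.symm.injective h
  -- the periods
  obtain ⟨p₀, hp₀⟩ : ∃ w : ℂ, w = Φ (Pi.single (σ.symm 0) (1 : ℝ)) 0 := ⟨_, rfl⟩
  obtain ⟨p₁, hp₁⟩ : ∃ w : ℂ, w = Φ (Pi.single (σ.symm 1) (1 : ℝ)) 0 := ⟨_, rfl⟩
  have hsum : ∀ x : ι → ℝ, Φ x 0 = (x (σ.symm 0) : ℂ) * p₀ + (x (σ.symm 1) : ℂ) * p₁ := by
    intro x
    have hx : x = ∑ i, x i • Pi.single i (1 : ℝ) := by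
      conv_lhs => rw [← Finset.univ_sum_single x]
      exact Finset.sum_congr rfl fun i _ => by rw [← Pi.single_smul', smul_eq_mul, mul_one]
    conv_lhs => rw [hx]
    rw [map_sum, Finset.sum_apply, ← Equiv.sum_comp σ.symm, Fin.sum_univ_two, hp₀, hp₁]
    simp only [_root_.map_smul, Pi.smul_apply, Complex.real_smul]
  have indep : LinearIndependent ℝ ![p₀, p₁] := by
    refine LinearIndependent.pair_iff.mpr fun s t hst ↦ ?_
    obtain ⟨x, hx⟩ : ∃ x : ι → ℝ,
        x = s • Pi.single (σ.symm 0) (1 : ℝ) + t • Pi.single (σ.symm 1) (1 : ℝ) := ⟨_, rfl⟩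
    have hx0 : x (σ.symm 0) = s := by simp [hx, hne]
    have hx1 : x (σ.symm 1) = t := by simp [hx, hne.symm]
    have hΦx : Φ x = 0 := by
      funext j
      rw [Subsingleton.elim j 0, hsum, hx0, hx1, Pi.zero_apply]
      rw [Complex.real_smul, Complex.real_smul] at hst
      exact hst
    have hx' : x = 0 := by
      have h := congrArg Φ.symm hΦx
      rwa [ContinuousLinearEquiv.symm_apply_apply, map_zero] at h
    exact ⟨by rw [← hx0, hx', Pi.zero_apply], by rw [← hx1, hx', Pi.zero_apply]⟩
  let L : PeriodPair := ⟨p₀, p₁, indep⟩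
  have hΛ : ∀ z : Fin 1 → ℂ, (∃ m : ι → ℤ, Φ (fun i => (m i : ℝ)) = z) ↔ z 0 ∈ L.lattice := by
    intro z
    rw [PeriodPair.mem_lattice]
    change (∃ m : ι → ℤ, Φ (fun i => (m i : ℝ)) = z) ↔ ∃ a b : ℤ, (a : ℂ) * p₀ + b * p₁ = z 0
    constructor
    · rintro ⟨m, rfl⟩
      refine ⟨m (σ.symm 0), m (σ.symm 1), ?_⟩
      rw [hsum]
      push_cast
      ring
    · rintro ⟨a, b, hab⟩
      refine ⟨fun i => if i = σ.symm 0 then a else b, funext fun j => ?_⟩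
      rw [Subsingleton.elim j 0, hsum, ← hab]
      simp [hne.symm]
  exact ⟨L.curve.scheme,
    ⟨L.curve.abelianVarietyOfAddHom L.curve.addHom L.curve.negHom L.curve.lift_pointEquiv_comp_addHom
        L.curve.pointEquiv_comp_negHom_geom,
      Motives.dim_abelianVarietyOfAddHom L.curve _ _ _ _, rfl⟩,
    L.curve.isSmoothProjective_scheme, _, DimOneTorus.isAnalytification_torusMap Φ L hΛ⟩

/-! ### Riemann's theorem in rank two, the elliptic curve remembered as an abelian variety -/

/-- **Riemann's theorem in rank two, abelian form: every polarisable effective weight-one `ℚ`-Hodge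
structure of dimension `2` is a Hodge quotient of `H¹(E(ℂ); ℚ)` of a ONE-DIMENSIONAL COMPLEX
ABELIAN VARIETY `E`.** Proof of `weightOne_geometric_of_lefschetzAt` (`n = 1`) verbatim — complex
structure `J` and integral Riemann form (`exists_cx_riemannForm_hom_of_isPolarizable`), the torus
`(V_ℝ, J)/Λ`, its algebraic model, `H¹` read on the model
(`weightOne_torusCohomology_of_isAnalytification`) — with the algebraic model supplied by
`exists_abelianVariety_isAnalytification_complexTorus_dimOne`, which remembers the group law.
[cite: VoisinHodgeI2002, §7.2.2] [cite: LangeBirkenhake1992, Thm. 2.1.18 and Cor. 2.1.14]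
[cite: SilvermanAEC2009, VI Prop. 3.6 (b)] -/
theorem weightOne_polarizable_of_finrank_eq_two_abelian {V : Type} [AddCommGroup V] [Module ℚ V]
    [Module.Finite ℚ V] (hV : Module.finrank ℚ V = 2) (H : HodgeStructure V 1)
    (hpol : H.IsPolarizable) (heff : H.IsEffective) :
    ∃ (X : SchemeOver ℂ), (∃ E : AbelianVariety ℂ, E.dim = 1 ∧ E.X = X) ∧
      ∃ (hX : IsSmoothProjective 1 X) (B : HodgeModel 1 X) (hB : B.IsHodgeSymmetric)
        (f : HodgeStructure.Hom ((B.hodgeStructure hX hB 1).cast Nat.cast_one) H),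
        Function.Surjective f.toLinearMap := by
  classical
  obtain ⟨J, hJ, E, hE, hEJ, hpos, -, e, he⟩ :=
    exists_cx_riemannForm_hom_of_isPolarizable H hpol heff
  have hJ' : J * J = -1 := LinearMap.ext fun a => by simp [Module.End.mul_apply, hJ a]
  have hn : Module.finrank ℝ (ℝ ⊗[ℚ] V) = 2 * 1 := by rw [Module.finrank_baseChange, hV]
  obtain ⟨X, hXE, hX, φ, hφ⟩ := exists_abelianVariety_isAnalytification_complexTorus_dimOne
    (CxModule.periodIso J hJ' hn ((Module.finBasis ℚ V).baseChange ℝ))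
  obtain ⟨B, hB, f, hf⟩ :=
    weightOne_torusCohomology_of_isAnalytification J hJ hJ' E hE hEJ hpos hn X hX φ hφ
  exact ⟨X, hXE, hX, B, hB, e.comp f, he.comp hf⟩

/-- **Rank-two Riemann, abelian form — the registered sub-goal of the line** (lead c3, crux
stmt-HodgeConjecture-3540; `weightOne_polarizable_of_finrank_eq_two_abelian` with all binders after
the colon): every polarisable effective weight-one `ℚ`-Hodge structure of dimension `2` is a Hodge
quotient of `H¹(E(ℂ); ℚ)` of a one-dimensional complex abelian variety `E`.
[cite: VoisinHodgeI2002, §7.2.2] [cite: LangeBirkenhake1992, Thm. 2.1.18 and Cor. 2.1.14] -/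
theorem rankTwoRiemann_abelianCurve : ∀ ⦃V : Type⦄ [AddCommGroup V] [Module ℚ V] [Module.Finite ℚ V], Module.finrank ℚ V = 2 → ∀ (H : Literature.AlgebraicGeometry.Motives.HodgeStructure V 1), H.IsPolarizable → H.IsEffective → ∃ (X : SchemeOver ℂ), (∃ E : AbelianVariety ℂ, E.dim = 1 ∧ E.X = X) ∧ ∃ (hX : IsSmoothProjective 1 X) (B : HodgeModel 1 X) (hB : B.IsHodgeSymmetric) (f : Literature.AlgebraicGeometry.Motives.HodgeStructure.Hom ((B.hodgeStructure hX hB 1).cast Nat.cast_one) H), Function.Surjective f.toLinearMap :=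
  fun _ _ _ _ hV H hpol heff ↦ weightOne_polarizable_of_finrank_eq_two_abelian hV H hpol heff

end Summit.HodgeConjecture.HodgeConjecture.Theorems

end
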